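import Summits.HodgeConjecture.HodgeConjecture.Theorems.CYFormCasimirCYFormCarrierEightNorm
import Summits.HodgeConjecture.HodgeConjecture.Theorems.CYFormCasimirCYFormCarrierEightOperatorCriterion
import Summits.HodgeConjecture.HodgeConjecture.Theorems.CYFormCasimirCYFormCarrierEightRatOperator
import Literature.AlgebraicGeometry.HodgeTheory.HyperbolicWeilTypeBalanced
import HarnessLib

/-!
# Crux X1 `CYFormCarrierEight` (route `CYFormCasimir`, stmt-HodgeConjecture-23493), helper file 22:
# THE CY FORM EXISTS — the registered stub `stub_cyform_exists` of `Cruxes/CYFormCarrierEight/Lines/birth.lean`, inlined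

research route conditional on HC_CM; not a corollary. Nothing here proves HC, HC_CM, the rung H2, the crux X1 (which also asks
for a CARRIER of the CY form — the open realisation problem, `stub_carrier_of_cyform`) or the route. This file proves the
FIRST of the two load-bearing stubs of the crux skeleton: on every Hodge-general (`Hg = SU_H`) hyperbolic split
`ℚ(√-d)`-Weil abelian eightfold `(A, φ)` there is a Calabi–Yau form `T ⊂ H⁴(A(ℂ); ℂ)` — `T ≤ ⋀⁴W ⊕ ⋀⁴W^*`, `T ∩ ⋀⁴W = 0`,
`dim T = 70`, `T` spanned by rational classes and by pure-type classes (Friedman–Laza, Prop. 37: `⋀ⁿ_K H¹` contains a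
`ℚ`-sub-Hodge structure of CY type iff the rescaled Hodge star is an involution, which holds in the hyperbolic case).

Assembly (`cyFormExists_eight`, signature = the registered stub with the skeleton's abbreviations `symH`, `IsCYFormAt` inlined):
pick a non-zero RATIONAL Weil class `w₀ = v' + v` (`v' ∈ ⋀⁸W`, `v ∈ ⋀⁸W^*`, both non-zero); take the duality operators `s₊`
(datum `v`) and `s₋` (datum `v'`) of helper file 14; `s₋ s₊ = λ₀` on `⋀⁴W` (helper file 17) with `λ₀ = P² + dQ²`, `P, Q ∈ ℚ`
(helper file 21, the hyperbolicity input); rescale by the rational operator `R = p'·𝟙 + q'·J` (`J = ±i√d` on `⋀⁴W^{(*)}`,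
helper file 6) with `(p' + q'i√d)(p' - q'i√d) = 1/λ₀`; then `s := (s₊ + s₋) ∘ R` exchanges `⋀⁴W` and `⋀⁴W^*`, squares to `𝟙` on
`⋀⁴W`, commutes with all coefficient twists (helper file 18 ⇒ rational, helper file 6) and preserves Hodge types on `⋀⁴W^*`
(helper file 17), so the operator criterion (helper file 4) yields `T = (𝟙 + s)(⋀⁴W^*)`.

References: FriedmanLaza2013 (§2.4.2, §3.5 Lemma 36, Prop. 37), vanGeemen1994HodgeAV (4.9, Lemma 5.2, 5.4, Thm. 6.12),
MoonenZarhin1998WeilClasses (§1), Deligne1982HodgeCycles (I §3).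
-/

-- `Summit.HodgeConjecture.HodgeConjecture.…` is the tree's mandated summit/problem namespace (single-problem summit).
set_option linter.dupNamespace false
noncomputable section

open CategoryTheory
open Literature.AlgebraicTopology.SingularHomology
open Literature.AlgebraicGeometry.Motives
open Literature.AlgebraicGeometry.HodgeTheory
open Literature.AlgebraicGeometry.VanGeemen1994

namespace Summit.HodgeConjecture.HodgeConjecture.Theorems.CYFormCarrier

section WeilClass

variable {A : AbelianVariety ℂ} {d : ℕ} {φ : A ⟶ A}
variable (hd : 0 < d) (hA : A.dim = 2 * 4) (hφ : φ ≫ φ = -(d • 𝟙 A))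
  (e : ProjectiveEmbedding A.X) {a : complexBetti (projectiveSpace e.n ℂ) 2} (ha : IsRationalClass a) (ha0 : a ≠ 0)

include hd hA hφ e ha ha0 in
/-- **A non-zero rational Weil class and its two non-zero components** `v' ∈ ⋀⁸W`, `v ∈ ⋀⁸W^*`: the Weil plane is
non-zero and spanned by rational classes; a rational class of the plane with a vanishing component would lie in one
eigen-line and be moved off it by complex conjugation. [cite: MoonenZarhin1998WeilClasses, §1] [cite: vanGeemen1994HodgeAV, 4.9 and Lemma 5.2 (6)] -/
theorem exists_rational_weilClass_components :
    ∃ v' v : complexBetti A.X (2 * 4), v' ∈ weilClassesPlus A φ 4 d ∧ v ∈ weilClassesMinus A φ 4 d ∧ v' ≠ 0 ∧ v ≠ 0 ∧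
      IsRationalClass (v' + v) := by
  classical
  have h0 : weilClassesPlus A φ 4 d ⊓ weilClassesMinus A φ 4 d = ⊥ := weilClassesPlus_inf_weilClassesMinus (by norm_num) hd
  -- a non-zero rational class in the Weil plane
  have hne : ∃ w₀ ∈ weilClassesOf A φ 4 d, IsRationalClass w₀ ∧ w₀ ≠ 0 := by
    by_contra hall
    push Not at hall
    have hle : weilClassesOf A φ 4 d ≤ ⊥ := by
      refine (weilClassesOf_le_span_isRationalClass hd hφ 4).trans ?_
      rw [Submodule.span_le]
      rintro c ⟨hc, hcr⟩
      simp only [SetLike.mem_coe, Submodule.mem_bot]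
      exact hall c hc hcr
    have hTP := TP_mem_weilClassesPlus (by omega) hd hA hφ e ha ha0
    have hTP0 : TP (by omega) hd hA hφ e ha ha0 = 0 := by
      rw [← Submodule.mem_bot ℂ]; exact hle (weilClassesPlus_le_weilClassesOf A φ 4 d hTP)
    exact (Module.Basis.ne_zero _ _) hTP0
  obtain ⟨w₀, hw₀, hw₀r, hw₀0⟩ := hne
  obtain ⟨v', hv', v, hv, rfl⟩ := Submodule.mem_sup.1 hw₀
  obtain ⟨κ, hκ⟩ := exists_ringEquiv_apply_I_mul_sqrt_eq_neg d
  obtain ⟨h1, h2⟩ := coeffClass_weilComponents_of_swap hd κ hκ hv' hv hw₀r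
  refine ⟨v', v, hv', hv, ?_, ?_, hw₀r⟩
  · intro h0'
    -- `v' = 0 ⇒ v = σ_* v' = 0`
    apply hw₀0
    rw [h0', zero_add, ← h1, h0', map_zero]
  · intro h0'
    apply hw₀0
    rw [h0', add_zero, ← h2, h0', map_zero]

end WeilClass

/-- **The CY form exists (`stub_cyform_exists` of the crux skeleton, inlined).** For every `d > 0` and every complex abelian
eightfold `A` with `φ ≫ φ = -d`, a rational non-zero class `a` on the ambient projective space of an embedding `e`,
`(A, φ)` HYPERBOLIC and HODGE-GENERAL (`Hg = SU_H`) for the `K`-symmetrised class `h_K = d·e^*a + φ^*e^*a`, there is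
`T ⊂ H⁴(A(ℂ); ℂ)` with `T ≤ ⋀⁴W ⊕ ⋀⁴W^*`, `T ∩ ⋀⁴W = 0`, `dim T = 70`, `T` spanned by its rational classes and by its pure-type
classes. [cite: FriedmanLaza2013, §2.4.2 and §3.5 Prop. 37] [cite: vanGeemen1994HodgeAV, Lemma 5.2, 5.4 and Thm. 6.12]
[cite: MoonenZarhin1998WeilClasses, §1] -/
theorem cyFormExists_eight :
    ∀ d : ℕ, 0 < d → ∀ (A : AbelianVariety ℂ) (φ : A ⟶ A) (e : ProjectiveEmbedding A.X)
      (a : complexBetti (projectiveSpace e.n ℂ) 2), A.dim = 2 * 4 → φ ≫ φ = -(d • 𝟙 A) → IsRationalClass a → a ≠ 0 →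
      IsHyperbolicWeilType A φ 4
        ((d : ℂ) • complexBetti.map e.ι 2 a + complexBetti.map φ.hom.hom.hom 2 (complexBetti.map e.ι 2 a)) →
      HasHodgeGroupSU A φ 4 d
        ((d : ℂ) • complexBetti.map e.ι 2 a + complexBetti.map φ.hom.hom.hom 2 (complexBetti.map e.ι 2 a)) →
      ∃ T : Submodule ℂ (complexBetti A.X (2 * 2)),
        T ≤ pullbackEigenclasses A φ (2 * 2)
              (fun x y => ((x : ℂ) + (y : ℂ) * Complex.I * (Real.sqrt d : ℂ)) ^ 4) ⊔
            pullbackEigenclasses A φ (2 * 2)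
              (fun x y => ((x : ℂ) - (y : ℂ) * Complex.I * (Real.sqrt d : ℂ)) ^ 4) ∧
        T ⊓ pullbackEigenclasses A φ (2 * 2)
              (fun x y => ((x : ℂ) + (y : ℂ) * Complex.I * (Real.sqrt d : ℂ)) ^ 4) = ⊥ ∧
        Module.finrank ℂ T = 70 ∧
        T ≤ Submodule.span ℂ {c | c ∈ T ∧ IsRationalClass c} ∧
        T ≤ Submodule.span ℂ {c | c ∈ T ∧ ∃ p q : ℕ, p + q = 4 ∧ IsOfHodgeType (2 * 4) A.X (2 * 2) p q c} := by
  intro d hd A φ e a hA hφ ha ha0 hhyp hSU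
  classical
  have hX : IsSmoothProjective (2 * 4) A.X := isSmoothProjective_of_dim_eq' hA
  have hqk : 2 * 2 + 2 * 2 = Fintype.card (Fin (2 * 4)) := by rw [Fintype.card_fin]
  set s : ℂ := Complex.I * (Real.sqrt d : ℂ) with hs
  have hs2 : s ^ 2 = -(d : ℂ) := I_mul_sqrt_sq d
  -- Weil classes are Hodge classes (hyperbolic ⇒ balanced)
  have hW : ∀ c ∈ weilClassesOf A φ 4 d, IsOfHodgeType (2 * 4) A.X (2 * 4) 4 4 c := fun c hc ↦
    isOfHodgeType_of_mem_weilClassesOf_of_isHyperbolicWeilType (n := 4) (by norm_num) hd hA hφ e ha ha0 hhyp hc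
  -- a rational Weil class and its components
  obtain ⟨v', v, hv', hv, hv0', hv0, hw⟩ := exists_rational_weilClass_components hd hA hφ e ha ha0
  have hvW : v ∈ weilClassesOf A φ 4 d := Submodule.mem_sup_right hv
  have hvW' : v' ∈ weilClassesOf A φ 4 d := Submodule.mem_sup_left hv'
  -- the duality operators (built in the tree's Weil frame)
  set w := wBasis hd hφ hA with hw_def
  set b := weilBasis (m := 2 * 4 - 1) (k := 2 * 4) (by omega) (by omega) hd hφ e ha ha0 w with hbdef
  have hb : b = weilBasis (m := 2 * 4 - 1) (k := 2 * 4) (by omega) (by omega) hd hφ e ha ha0 w := rfl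
  obtain ⟨S, hS1all, hS0, hS2⟩ := exists_starPlus hd hA hφ e ha ha0 w b hb hSU hqk v
  obtain ⟨S', hS'1all, hS'0, hS'2⟩ := exists_starMinus hd hA hφ e ha ha0 w b hb hSU hqk v'
  have hS1 : ∀ x ∈ weilClassesPlus A φ 2 d, S x ∈ weilClassesMinus A φ 2 d := fun x _ ↦ hS1all x
  have hS'1 : ∀ y ∈ weilClassesMinus A φ 2 d, S' y ∈ weilClassesPlus A φ 2 d := fun y _ ↦ hS'1all y
  -- `s₋ s₊ = λ₀`, `λ₀ = P² + dQ²`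
  obtain ⟨lam, hlam0, hlam⟩ := exists_starMinus_starPlus_eq_smul hd hA hφ e ha ha0 hSU hW hv hv0 hv' hv0' S hS1 hS2 S' hS'1 hS'2
  obtain ⟨P, Q, hPQ⟩ := exists_rat_sq_add_mul_sq_eq hd hA hφ e ha ha0 hSU hhyp hv hv' hw S hS1 hS2 S' hS'1 hS'2 hlam
  set lamQ : ℚ := P ^ 2 + d * Q ^ 2 with hlamQ
  have hlamQ_cast : (lamQ : ℂ) = lam := by rw [hlamQ, hPQ]; push_cast; ring
  have hlamQ0 : lamQ ≠ 0 := fun h ↦ hlam0 (by rw [← hlamQ_cast, h, Rat.cast_zero])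
  -- the rational rescaling `R = p'·𝟙 + q'·J`, `p' + q' i√d = (P - Q i√d)/λ₀`
  obtain ⟨J, hJp, hJm, hJrat, hJtyp, hJcomm⟩ := exists_ratOperator_I_sqrt (φ := φ) (d := d) hA
  set p' : ℚ := P / lamQ with hp'
  set q' : ℚ := -Q / lamQ with hq'
  set R : complexBetti A.X (2 * 2) →ₗ[ℂ] complexBetti A.X (2 * 2) := (p' : ℂ) • LinearMap.id + (q' : ℂ) • J with hR
  set γ : ℂ := (p' : ℂ) + (q' : ℂ) * s with hγ
  set γ' : ℂ := (p' : ℂ) - (q' : ℂ) * s with hγ'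
  have hRp : ∀ x ∈ weilClassesPlus A φ 2 d, R x = γ • x := by
    intro x hx
    rw [hR, LinearMap.add_apply, LinearMap.smul_apply, LinearMap.smul_apply, LinearMap.id_apply, hJp x hx, smul_smul,
      ← add_smul]
  have hRm : ∀ y ∈ weilClassesMinus A φ 2 d, R y = γ' • y := by
    intro y hy
    rw [hR, LinearMap.add_apply, LinearMap.smul_apply, LinearMap.smul_apply, LinearMap.id_apply, hJm y hy, smul_smul,
      ← add_smul, mul_neg, ← sub_eq_add_neg]
  have hγγ : γ * γ' * lam = 1 := by
    have h1 : γ * γ' = (p' : ℂ) ^ 2 + (d : ℂ) * (q' : ℂ) ^ 2 := by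
      rw [hγ, hγ']; linear_combination (-(q' : ℂ) ^ 2) * hs2
    have h2 : ((p' ^ 2 + d * q' ^ 2 : ℚ) : ℂ) * (lamQ : ℂ) = 1 := by
      have h3 : (p' ^ 2 + d * q' ^ 2) * lamQ = 1 := by
        rw [hp', hq']
        field_simp
        rw [hlamQ]
      rw [← Rat.cast_mul, h3, Rat.cast_one]
    rw [h1, ← hlamQ_cast, ← h2]
    push_cast
    ring
  -- the operator `s = (s₊ + s₋) ∘ R`
  set T₀ := (S + S') ∘ₗ R with hT₀
  have hT₀p : ∀ x ∈ weilClassesPlus A φ 2 d, T₀ x = γ • S x := by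
    intro x hx
    rw [hT₀, LinearMap.comp_apply, hRp x hx, map_smul, LinearMap.add_apply, hS'0 x hx, add_zero]
  have hT₀m : ∀ y ∈ weilClassesMinus A φ 2 d, T₀ y = γ' • S' y := by
    intro y hy
    rw [hT₀, LinearMap.comp_apply, hRm y hy, map_smul, LinearMap.add_apply, hS0 y hy, zero_add]
  refine exists_cyForm_of_operator hd hA hφ T₀ ?_ ?_ ?_ ?_ ?_
  · -- `s(⋀⁴W^*) ≤ ⋀⁴W`
    rintro _ ⟨y, hy, rfl⟩
    rw [hT₀m y hy]
    exact Submodule.smul_mem _ _ (hS'1 y hy)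
  · -- `s(⋀⁴W) ≤ ⋀⁴W^*`
    rintro _ ⟨x, hx, rfl⟩
    rw [hT₀p x hx]
    exact Submodule.smul_mem _ _ (hS1 x hx)
  · -- `s (s x) = x` on `⋀⁴W`
    intro x hx
    rw [hT₀p x hx, map_smul, hT₀m _ (hS1 x hx), hlam x hx, smul_smul, smul_smul, hγγ, one_smul]
  · -- rationality: `s` commutes with every coefficient twist on the Weil space
    refine isRationalClass_apply_of_coeffClass_comm hA T₀ fun σ c hc ↦ ?_
    have hRc : R c ∈ weilClassesOf A φ 2 d := by
      obtain ⟨x, hx, y, hy, rfl⟩ := Submodule.mem_sup.1 hc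
      rw [map_add, hRp x hx, hRm y hy]
      exact Submodule.add_mem _ (Submodule.mem_sup_left (Submodule.smul_mem _ _ hx))
        (Submodule.mem_sup_right (Submodule.smul_mem _ _ hy))
    have hRτ : coeffClass (R := ℂ) (S := ℂ) σ.toRingHom.toAddMonoidHom (2 * 2) (R c) =
        R (coeffClass (R := ℂ) (S := ℂ) σ.toRingHom.toAddMonoidHom (2 * 2) c) := by
      rw [hR, LinearMap.add_apply, LinearMap.smul_apply, LinearMap.smul_apply, LinearMap.id_apply, map_add,
        coeffClass_ringHom_smul, coeffClass_ringHom_smul, hJcomm σ.toRingHom c, LinearMap.add_apply, LinearMap.smul_apply,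
        LinearMap.smul_apply, LinearMap.id_apply]
      change σ _ • _ + σ _ • _ = _
      rw [map_ratCast, map_ratCast]
    rw [hT₀, LinearMap.comp_apply, LinearMap.comp_apply,
      starSum_coeffClass_comm hd hA hφ e ha ha0 σ S S' v v' hS1 hS2 hS'1 hS'2 hSU hS0 hS'0 hv' hv hw hRc, hRτ]
  · -- Hodge types on `⋀⁴W^*`
    intro c hc p q hpq hct
    obtain ⟨M⟩ := nonempty_hodgeModel_holds hX
    have hpq' : (p, q) ∈ Finset.HasAntidiagonal.antidiagonal (2 * 2) := Finset.HasAntidiagonal.mem_antidiagonal.2 hpq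
    have hmem : c ∈ M.typePiece (2 * 2) ⟨(p, q), hpq'⟩ := (M.mem_typePiece_iff_isOfHodgeType' hX ⟨(p, q), hpq'⟩ c).2 hct
    have hS'c : S' c ∈ M.typePiece (2 * 2) ⟨(p, q), hpq'⟩ :=
      starMinus_mem_typePiece hd hA hφ e ha ha0 hSU hW hvW' S' hS'1 hS'2 M ⟨(p, q), hpq'⟩ hc hmem
    rw [hT₀m c hc]
    exact ((M.mem_typePiece_iff_isOfHodgeType' hX ⟨(p, q), hpq'⟩ _).1 hS'c).smul γ'

end Summit.HodgeConjecture.HodgeConjecture.Theorems.CYFormCarrier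

end
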